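import Literature.Analysis.DeBrangesSpaces.Basic
import HarnessLib

/-!
# de Branges' positivity theorem in the form of Conrey–Li 2000, Theorem 1 (named fact)

Cite item `wi-08778`, for route `RiemannHypothesis/DeBrangesShift` (Assembly
`stmt-RiemannHypothesis-1525`: first conclusion applied to `E_c(z) = ξ(1/2 + c − 2icz)`, `c ≥ 1/2`;
`KernelNecessity` `stmt-RiemannHypothesis-1522`: second conclusion), over the vocabulary of
`Literature/Analysis/DeBrangesSpaces/Basic.lean` (`IsHermiteBiehler`, `sharp`, `deBrangesInner`,
`deBrangesNormSq`, `deBrangesKernelDiag`, `HasKernelBound`).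

J. B. Conrey, X.-J. Li, *A note on some positivity conditions related to zeta and L-functions*,
IMRN 2000 = arXiv:math/9812166, §2, **Theorem 1** (read, arXiv p. 1; "essentially due to
de Branges (cf. [2] [3])", proof pp. 1–2 via the reproducing-kernel identity (2.2), the shift
identity (2.3) and the Schwarz inequality (2.5)), verbatim:

> Let `E(z)` be an entire function having no real zeros such that `|E(z̄)| < |E(z)|` for
> `Im z > 0`, such that `Ē(z̄) = ε E(z − i)` for a constant `ε` of absolute value one, and such that
> `|E(x+iy)|` is a strictly increasing function of `y > 0` for each fixed real `x`. If
> `Re ⟨F(z), F(z+i)⟩_{𝓗(E)} ≥ 0` for every element `F(z) ∈ 𝓗(E)` with `F(z+i) ∈ 𝓗(E)`, then the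
> zeros of `E(z)` lie on the line `Im z = −1/2`, and `Re{Ē′(w) E(w+i)/2πi} ≥ 0` when `w` is a zero
> of `E(z)`.

Rendering (`conreyLi2000_thm1`):
* `𝓗(E)`-membership is Conrey–Li's own definition (2.1) (§2, same page): `F` entire, `F/E`
  square integrable on `ℝ` (`Integrable ‖F x / E x‖²`), and `‖F(z)‖² ≤ ‖F‖² K(z, z)` — the tree's
  `HasKernelBound E F` (imposed off the real axis, where `K(z,z) = deBrangesKernelDiag E z`; at real
  points (2.1) follows by continuity). This is literally the `Mem` inlined in the route statements.
  It is NOT replaced by the tree's `DeBrangesSpace E` (Romanov's pointwise characterization with an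
  existential constant): that set contains the (2.1)-members (`DeBrangesSpace.mem_of_hasKernelBound`)
  and quantifying over it would change the hypothesis.
* `⟨F, G⟩_{𝓗(E)} = ∫ F(x) conj G(x)/|E(x)|² dx` is `deBrangesInner E F G`; Conrey–Li's `Ē(z̄)` is
  `conj (E (conj z)) = sharp E z`, and `Ē′(w)` is `conj (E′(w))` (value conjugation, as in their
  kernel formula `E(z)Ē(w)`).
* "`|E(x+iy)|` strictly increasing in `y > 0`": `StrictMonoOn (y ↦ ‖E (x + y i)‖) (0, ∞)`.

Proved: the two conclusions separately (`.zeros_im_eq`, `.re_kernel_nonneg`). What is NOT here: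
the proof (it needs `K(w, ·) ∈ 𝓗(E)` and the reproducing identity (2.2), i.e. Cauchy's formula in
both half-planes for `F/E`, `F♯/E` — de Branges 1968, Thms 19–23; not in the tree), and Conrey–Li's
Theorem 2 / §3 (the spaces `𝓗(E_χ)`).

## References

* J. B. Conrey, X.-J. Li, IMRN 2000:18, 929–940 = arXiv:math/9812166, §2 Theorem 1 (read)
  [ConreyLi2000].
* L. de Branges, *The Riemann hypothesis for Hilbert spaces of entire functions*, Bull. AMS 15
  (1986) 1–17 [deBranges1986]; *Hilbert spaces of entire functions* (1968).
-/

noncomputable section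

open scoped ComplexConjugate Real
open _root_.Complex _root_.MeasureTheory

namespace Literature.Analysis.DeBrangesSpaces

/-- **de Branges' positivity theorem, as stated and proved by Conrey–Li (2000), Theorem 1.**
For an entire `E` with no real zeros, `|E(z̄)| < |E(z)|` on `Im z > 0` (`IsHermiteBiehler E`),
`E♯(z) = ε E(z − i)` for some `|ε| = 1`, and `y ↦ |E(x + iy)|` strictly increasing on `(0, ∞)` for
every real `x`: IF `Re ⟨F, F(· + i)⟩_{𝓗(E)} ≥ 0` for every `F` in `𝓗(E)` — Conrey–Li's (2.1):
`F` entire, `∫ |F/E|² < ∞` on `ℝ`, `|F(z)|² ≤ ‖F‖² K(z,z)` (`HasKernelBound`) — whose shift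
`F(· + i)` is also in `𝓗(E)`, THEN every zero `w` of `E` has `Im w = −1/2`, and
`Re{conj(E′(w)) E(w + i)/(2πi)} ≥ 0` at every zero `w` of `E`.
[cite: ConreyLi2000, Theorem 1] -/
def conreyLi2000_thm1 : Prop :=
  ∀ E : ℂ → ℂ, IsHermiteBiehler E → (∀ x : ℝ, E x ≠ 0) →
    (∃ ε : ℂ, ‖ε‖ = 1 ∧ ∀ z : ℂ, sharp E z = ε * E (z - I)) →
    (∀ x : ℝ, StrictMonoOn (fun y : ℝ => ‖E (x + y * I)‖) (Set.Ioi 0)) →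
    (∀ F : ℂ → ℂ,
      (Differentiable ℂ F ∧ Integrable (fun x : ℝ => ‖F x / E x‖ ^ 2) ∧ HasKernelBound E F) →
      (Differentiable ℂ (fun z => F (z + I)) ∧
          Integrable (fun x : ℝ => ‖F (x + I) / E x‖ ^ 2) ∧ HasKernelBound E (fun z => F (z + I))) →
        0 ≤ (deBrangesInner E F (fun z => F (z + I))).re) →
    (∀ w : ℂ, E w = 0 → w.im = -1 / 2) ∧
    (∀ w : ℂ, E w = 0 → 0 ≤ (conj (deriv E w) * E (w + I) / (2 * π * I)).re)

namespace conreyLi2000_thm1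

/-- **First conclusion** of Conrey–Li's Theorem 1: under its hypotheses, all zeros of `E` lie on
the line `Im z = −1/2`. [cite: ConreyLi2000, Theorem 1] -/
theorem zeros_im_eq (h : conreyLi2000_thm1) {E : ℂ → ℂ} (hE : IsHermiteBiehler E)
    (hreal : ∀ x : ℝ, E x ≠ 0) (hε : ∃ ε : ℂ, ‖ε‖ = 1 ∧ ∀ z : ℂ, sharp E z = ε * E (z - I))
    (hmono : ∀ x : ℝ, StrictMonoOn (fun y : ℝ => ‖E (x + y * I)‖) (Set.Ioi 0))
    (hpos : ∀ F : ℂ → ℂ,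
      (Differentiable ℂ F ∧ Integrable (fun x : ℝ => ‖F x / E x‖ ^ 2) ∧ HasKernelBound E F) →
      (Differentiable ℂ (fun z => F (z + I)) ∧
          Integrable (fun x : ℝ => ‖F (x + I) / E x‖ ^ 2) ∧ HasKernelBound E (fun z => F (z + I))) →
        0 ≤ (deBrangesInner E F (fun z => F (z + I))).re)
    {w : ℂ} (hw : E w = 0) : w.im = -1 / 2 :=
  (h E hE hreal hε hmono hpos).1 w hw

/-- **Second conclusion** of Conrey–Li's Theorem 1: under its hypotheses,
`Re{conj(E′(w)) E(w + i)/(2πi)} ≥ 0` at every zero `w` of `E` (the "kernel test", `K(w, w+i)`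
in the notation of the proof, (2.5)). [cite: ConreyLi2000, Theorem 1] -/
theorem re_kernel_nonneg (h : conreyLi2000_thm1) {E : ℂ → ℂ} (hE : IsHermiteBiehler E)
    (hreal : ∀ x : ℝ, E x ≠ 0) (hε : ∃ ε : ℂ, ‖ε‖ = 1 ∧ ∀ z : ℂ, sharp E z = ε * E (z - I))
    (hmono : ∀ x : ℝ, StrictMonoOn (fun y : ℝ => ‖E (x + y * I)‖) (Set.Ioi 0))
    (hpos : ∀ F : ℂ → ℂ,
      (Differentiable ℂ F ∧ Integrable (fun x : ℝ => ‖F x / E x‖ ^ 2) ∧ HasKernelBound E F) →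
      (Differentiable ℂ (fun z => F (z + I)) ∧
          Integrable (fun x : ℝ => ‖F (x + I) / E x‖ ^ 2) ∧ HasKernelBound E (fun z => F (z + I))) →
        0 ≤ (deBrangesInner E F (fun z => F (z + I))).re)
    {w : ℂ} (hw : E w = 0) : 0 ≤ (conj (deriv E w) * E (w + I) / (2 * π * I)).re :=
  (h E hE hreal hε hmono hpos).2 w hw

end conreyLi2000_thm1

/-- Sanity remark on the monotonicity hypothesis: it is non-vacuous and genuinely about `E` — for
the constant function `1` (entire, no zeros, but NOT Hermite–Biehler) the map `y ↦ ‖1‖` is not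
strictly increasing, so such degenerate `E` are excluded twice over. [folklore] -/
example : ¬ StrictMonoOn (fun y : ℝ => ‖(fun _ : ℂ => (1 : ℂ)) ((0 : ℝ) + y * I)‖) (Set.Ioi 0) := by
  intro h
  have := h (show (1 : ℝ) ∈ Set.Ioi 0 by norm_num) (show (2 : ℝ) ∈ Set.Ioi 0 by norm_num)
    (by norm_num)
  simp at this

end Literature.Analysis.DeBrangesSpaces

end
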